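import Literature.NumberTheory.GaloisRepresentations.LubinTateColemanRelativeCoordTwo
import Literature.NumberTheory.GaloisRepresentations.LubinTateColemanRelativeBaseNormTwo
import Literature.NumberTheory.GaloisRepresentations.PowerSeriesTopNilpotentContinuous
import HarnessLib

/-!
# The Coleman map is CONTINUOUS (relative case, `q = 2`): `𝒰(E·K_π^∞)` is a compact group and `β ↦ g_β`, `β ↦ δ_E g_β`,
# `β ↦ (δ_E g_β)~`, `β ↦ r_β` are continuous for the coefficientwise topology on `𝒪_E⟦X⟧`

De Shalit, *Iwasawa theory of elliptic curves with complex multiplication* (1987), Ch. I §2.2 ("`𝒰 = lim← U(k_ξ^n)`" — an inverse limit of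
compact groups), §3.4 Corollary ("`i` is an injective homomorphism of `ℤ_p⟦𝒢⟧`-modules": `ℤ_p⟦𝒢⟧`-linearity of a map specified on group
elements needs CONTINUITY) and §3.7 ("`i` was extended by linearity to the completed tensor product `𝒰 ⊗̂ 𝒪_K`": again continuity).  The
relative Coleman theory of the tree at `q = 2` (`RelNormCoherentUnits hπ E` along `E·K_π^{m+1}`, `E ⊆ F^{nr}` finite Galois;
`relColemanSeries` `g_β`, `relLogDerivSeries` `δβ`, `relTildeSeries` `(δβ)~`, `relUnitCoordTwo` `r_β` with `(δβ)~ = (1+u⁻¹X)(r_β ∘ f)`) was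
built through `∃!`-characterisations with no topology on `𝒰`.  THIS file (everything PROVED, 0 sorry):

* §1 tools: automorphisms `σ ∈ Aut_F(E)` and their restrictions `unitBallEquiv`/`frobUnitBall` are continuous (isometries); the relative norms
  `N_{E₂/E₁}` of subfields of `F̄` are continuous (`continuous_towerNorm`, product of conjugates); inversion on `{‖x‖ = 1}`.
* §2 `RelNormCoherentUnits hπ E` as a topological space (induced from `∏_m 𝒪_{E K_π^{m+1}}`): `val` is a CLOSED embedding (norm-one and
  norm-coherence are closed conditions), hence ★ `CompactSpace` and `T2Space`; `mul`, `inv` (NEW: the componentwise inverse), `baseNorm` are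
  continuous.
* §3 ★★ `continuous_relColemanSeries` — **`β ↦ g_β` is continuous** (CLOSED GRAPH: `g = g_β` iff `((φ⁻¹)^{m+1}g)^ι(ω_{m+1}) = β_m` for all
  `m`, closed conditions by `continuous_evS`; the target `𝒪_E⟦X⟧` is compact).
* §4 ★ `continuous_relLogDerivSeries` (`δβ = ω·g_β'·g_{β⁻¹}`), ★ `continuous_relTildeSeries`, ★★ `continuous_relUnitCoordTwo` — **`β ↦ r_β` is
  continuous** (closed graph: `(1+u⁻¹X)(r ∘ f) = (δβ)~`).

## References
* E. de Shalit, *Iwasawa theory of elliptic curves with complex multiplication* (1987), Ch. I §2.2, §3.4 Corollary, §3.7. [deShalit1987]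
* J.-P. Serre, *Local Fields* (1979), Ch. II §1–2 (compactness of `𝒪_E`, automorphisms are isometries). [SerreLocalFields1979]
* N. Bourbaki, *General Topology* Ch. I §10.2 Cor. 5 (closed graph), §9.5 Th. 3 (Tychonoff). [BourbakiGT1]
-/

noncomputable section

open Filter Topology
open scoped PowerSeries.WithPiTopology

namespace Literature.NumberTheory.GaloisRepresentations

section RelativeContinuousTwo

open GaloisRepresentations.IsNonarchimedeanLocalField LubinTate ValuativeRel Field

variable {F : Type} [Field F] [ValuativeRel F] [TopologicalSpace F] [IsNonarchimedeanLocalField F]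

attribute [local instance] ltNormUniformSpace ltNormIsUniformAddGroup rk1 nF nE fintypeResidueField

variable {π : 𝒪[F]} (hπ : (valuation F).IsUniformizer (π : F))

/-! ### §1. Continuity tools: automorphisms, inclusions, relative norms, inversion -/

section Tools

variable (E : IntermediateField F (AlgebraicClosure F)) [FiniteDimensional F E]

/-- An `F`-automorphism of `E` is continuous (an isometry for the spectral norm). [cite: SerreLocalFields1979, Ch. II §2 Cor. 3] -/
theorem continuous_algEquiv (σ : E ≃ₐ[F] E) : Continuous σ :=
  (AddMonoidHomClass.isometry_of_norm σ (norm_algEquiv σ)).continuous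

/-- `unitBallEquiv σ : 𝒪_E ≃+* 𝒪_E` is continuous. [cite: SerreLocalFields1979, Ch. II §2 Cor. 3] -/
theorem continuous_unitBallEquiv (σ : E ≃ₐ[F] E) : Continuous (unitBallEquiv E σ) :=
  Continuous.subtype_mk ((continuous_algEquiv E σ).comp continuous_subtype_val) _

variable [Normal F E]

/-- The Frobenius `frobUnitBall E σ₀` of `𝒪_E` is continuous. [cite: SerreLocalFields1979, Ch. II §2 Cor. 3] -/
theorem continuous_frobUnitBall (σ₀ : absoluteGaloisGroup F) : Continuous (frobUnitBall E σ₀ : unitBall E → unitBall E) :=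
  continuous_unitBallEquiv E _

/-- Its inverse is continuous. [cite: SerreLocalFields1979, Ch. II §2 Cor. 3] -/
theorem continuous_frobUnitBall_symm (σ₀ : absoluteGaloisGroup F) : Continuous ((frobUnitBall E σ₀).symm : unitBall E → unitBall E) :=
  continuous_unitBallEquiv E _

omit [Normal F E] in
/-- Coefficientwise Frobenius twists `(map ψ)^[k]` are continuous for continuous `ψ`. [cite: BourbakiGT1, Ch. I §4.1 Prop. 1] -/
theorem continuous_map_iterate {ψ : unitBall E →+* unitBall E} (hψ : Continuous ψ) (k : ℕ) :
    Continuous fun g : PowerSeries (unitBall E) => (PowerSeries.map ψ)^[k] g := by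
  induction k with
  | zero => exact continuous_id
  | succ k ih => simpa only [Function.iterate_succ'] using (PowerSeries.WithPiTopology.continuous_map ψ hψ).comp ih

end Tools

section Norms

variable {E₁ E₂ : IntermediateField F (AlgebraicClosure F)} [FiniteDimensional F E₁] [FiniteDimensional F E₂]

/-- The inclusion `E₁ → E₂` is continuous (an isometry). [cite: SerreLocalFields1979, Ch. II §2 Cor. 3] -/
theorem continuous_inclusion (h : E₁ ≤ E₂) : Continuous (IntermediateField.inclusion h) :=
  (AddMonoidHomClass.isometry_of_norm (IntermediateField.inclusion h) (norm_inclusion h)).continuous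

/-- The inclusion `E₁ → E₂` is a (closed) embedding. [cite: SerreLocalFields1979, Ch. II §2 Cor. 3] -/
theorem isEmbedding_inclusion (h : E₁ ≤ E₂) : Topology.IsEmbedding (IntermediateField.inclusion h) :=
  (AddMonoidHomClass.isometry_of_norm (IntermediateField.inclusion h) (norm_inclusion h)).isEmbedding

/-- ★ **The relative norm `N_{E₂/E₁}` is continuous** (`E₂/F` Galois): its composite with the inclusion is the product of the conjugates
`∏_{σ|E₁ = id} σ x`, each `σ` an isometry. [cite: SerreLocalFields1979, Ch. II §2 Cor. 3] -/
theorem continuous_towerNorm [IsGalois F E₂] (h : E₁ ≤ E₂) : Continuous fun x : E₂ => @Algebra.norm E₁ E₂ _ _ (towerAlgebra h) x := by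
  rw [(isEmbedding_inclusion h).continuous_iff]
  classical
  have e : (IntermediateField.inclusion h ∘ fun x : E₂ => @Algebra.norm E₁ E₂ _ _ (towerAlgebra h) x) =
      fun x => ∏ σ ∈ Finset.univ.filter (fun σ : E₂ ≃ₐ[F] E₂ =>
        ∀ y : E₁, σ (IntermediateField.inclusion h y) = IntermediateField.inclusion h y), σ x := by
    funext x
    rw [Function.comp_apply, algebraMap_towerNorm_eq_prod h x]
  rw [e]
  exact continuous_finsetProd _ fun σ _ => continuous_algEquiv E₂ σ

end Norms

/-! ### §2. `𝒰(E·K_π^∞)` as a compact topological space -/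

section Units

variable (E : IntermediateField F (AlgebraicClosure F)) [FiniteDimensional F E]

/-- **The topology of `𝒰(E·K_π^∞) = lim← 𝒪(E K_π^{m+1})^×`**: induced from the product `∏_m 𝒪_{E K_π^{m+1}}` of the (compact)
valuation rings. [cite: deShalit1987, Ch. I §2.2] -/
instance RelNormCoherentUnits.instTopologicalSpace : TopologicalSpace (RelNormCoherentUnits hπ E) :=
  TopologicalSpace.induced RelNormCoherentUnits.val inferInstance

/-- The components map `val` is continuous. [cite: deShalit1987, Ch. I §2.2] -/
theorem RelNormCoherentUnits.continuous_val : Continuous (RelNormCoherentUnits.val : RelNormCoherentUnits hπ E → _) :=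
  continuous_induced_dom

/-- Each component `β ↦ β_m` is continuous. [cite: deShalit1987, Ch. I §2.2] -/
theorem RelNormCoherentUnits.continuous_val_apply (m : ℕ) : Continuous fun β : RelNormCoherentUnits hπ E => β.val m :=
  (continuous_apply m).comp (RelNormCoherentUnits.continuous_val hπ E)

/-- `val` is injective. [cite: deShalit1987, Ch. I §2.2] -/
theorem RelNormCoherentUnits.val_injective : Function.Injective (RelNormCoherentUnits.val : RelNormCoherentUnits hπ E → _) :=
  fun _ _ h => RelNormCoherentUnits.ext fun m => congrFun h m

/-- `val` is an embedding (by definition of the topology). [cite: deShalit1987, Ch. I §2.2] -/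
theorem RelNormCoherentUnits.isEmbedding_val : Topology.IsEmbedding (RelNormCoherentUnits.val : RelNormCoherentUnits hπ E → _) :=
  ⟨⟨rfl⟩, RelNormCoherentUnits.val_injective hπ E⟩

/-- A map into `𝒰` is continuous iff all its components are. [cite: BourbakiGT1, Ch. I §4.1 Prop. 1] -/
theorem RelNormCoherentUnits.continuous_iff {X : Type*} [TopologicalSpace X] {f : X → RelNormCoherentUnits hπ E} :
    Continuous f ↔ ∀ m, Continuous fun x => (f x).val m := by
  rw [(RelNormCoherentUnits.isEmbedding_val hπ E).continuous_iff, continuous_pi_iff]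
  rfl

variable [IsGalois F E]

/-- **The range of `val` is closed**: "norm one" and "norm-coherent" are closed conditions (the norms being continuous).
[cite: deShalit1987, Ch. I §2.2] [cite: SerreLocalFields1979, Ch. II §2 Cor. 3] -/
theorem RelNormCoherentUnits.isClosed_range_val :
    IsClosed (Set.range (RelNormCoherentUnits.val : RelNormCoherentUnits hπ E → _)) := by
  have e : Set.range (RelNormCoherentUnits.val : RelNormCoherentUnits hπ E → _) =
      (⋂ m, {x : ∀ m : ℕ, unitBall (E ⊔ ltField π m : IntermediateField F (AlgebraicClosure F)) |
        ‖((x m : unitBall (E ⊔ ltField π m : IntermediateField F (AlgebraicClosure F))) :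
          (E ⊔ ltField π m : IntermediateField F (AlgebraicClosure F)))‖ = 1}) ∩
      ⋂ n, ⋂ m, ⋂ (hnm : n ≤ m), {x | @Algebra.norm (E ⊔ ltField π n : IntermediateField F (AlgebraicClosure F))
        (E ⊔ ltField π m : IntermediateField F (AlgebraicClosure F)) _ _
        (towerAlgebra (sup_le_sup_left (ltField_mono hπ hnm) E))
        ((x m : unitBall (E ⊔ ltField π m : IntermediateField F (AlgebraicClosure F))) :
          (E ⊔ ltField π m : IntermediateField F (AlgebraicClosure F))) =
      ((x n : unitBall (E ⊔ ltField π n : IntermediateField F (AlgebraicClosure F))) :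
        (E ⊔ ltField π n : IntermediateField F (AlgebraicClosure F)))} := by
    ext x
    simp only [Set.mem_range, Set.mem_inter_iff, Set.mem_iInter, Set.mem_setOf_eq]
    constructor
    · rintro ⟨β, rfl⟩
      exact ⟨β.norm_eq_one, β.coherent⟩
    · rintro ⟨h1, h2⟩
      exact ⟨⟨x, h1, h2⟩, rfl⟩
  rw [e]
  haveI : ∀ m, IsGalois F (E ⊔ ltField π m : IntermediateField F (AlgebraicClosure F)) := fun m => isGalois_sup_ltField hπ E m
  refine (isClosed_iInter fun m => isClosed_eq ?_ continuous_const).inter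
    (isClosed_iInter fun n => isClosed_iInter fun m => isClosed_iInter fun hnm => isClosed_eq ?_ ?_)
  · exact continuous_norm.comp (continuous_subtype_val.comp (continuous_apply m))
  · exact (continuous_towerNorm _).comp (continuous_subtype_val.comp (continuous_apply m))
  · exact continuous_subtype_val.comp (continuous_apply n)

/-- `val` is a closed embedding. [cite: deShalit1987, Ch. I §2.2] -/
theorem RelNormCoherentUnits.isClosedEmbedding_val :
    Topology.IsClosedEmbedding (RelNormCoherentUnits.val : RelNormCoherentUnits hπ E → _) :=
  ⟨RelNormCoherentUnits.isEmbedding_val hπ E, RelNormCoherentUnits.isClosed_range_val hπ E⟩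

/-- ★ **`𝒰(E·K_π^∞)` is COMPACT** (a closed subspace of a product of compact valuation rings). [cite: deShalit1987, Ch. I §2.2]
[cite: SerreLocalFields1979, Ch. II §1 Prop. 1] -/
instance RelNormCoherentUnits.instCompactSpace : CompactSpace (RelNormCoherentUnits hπ E) := by
  haveI : ∀ m : ℕ, CompactSpace (unitBall (E ⊔ ltField π m : IntermediateField F (AlgebraicClosure F))) :=
    fun m => compactSpace_unitBall _
  exact (RelNormCoherentUnits.isClosedEmbedding_val hπ E).compactSpace

omit [IsGalois F E] in
/-- `𝒰(E·K_π^∞)` is Hausdorff. [cite: deShalit1987, Ch. I §2.2] -/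
instance RelNormCoherentUnits.instT2Space : T2Space (RelNormCoherentUnits hπ E) :=
  (RelNormCoherentUnits.isEmbedding_val hπ E).t2Space

omit [IsGalois F E] in
/-- Multiplication `(β, β') ↦ ββ'` is continuous. [cite: deShalit1987, Ch. I §2.3 (i)] -/
theorem RelNormCoherentUnits.continuous_mul :
    Continuous fun ββ' : RelNormCoherentUnits hπ E × RelNormCoherentUnits hπ E => ββ'.1.mul ββ'.2 := by
  refine (RelNormCoherentUnits.continuous_iff hπ E).mpr fun m => ?_
  simp only [RelNormCoherentUnits.val_mul]
  exact ((RelNormCoherentUnits.continuous_val_apply hπ E m).comp continuous_fst).mul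
    ((RelNormCoherentUnits.continuous_val_apply hπ E m).comp continuous_snd)

omit [IsGalois F E] in
/-- The components of a norm-coherent unit are non-zero. [cite: deShalit1987, Ch. I §2.2] -/
theorem RelNormCoherentUnits.coe_val_ne_zero (β : RelNormCoherentUnits hπ E) (m : ℕ) :
    ((β.val m : unitBall (E ⊔ ltField π m : IntermediateField F (AlgebraicClosure F))) :
      (E ⊔ ltField π m : IntermediateField F (AlgebraicClosure F))) ≠ 0 := by
  intro h
  have h1 := β.norm_eq_one m
  rw [h, norm_zero] at h1
  exact zero_ne_one h1

omit [IsGalois F E] in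
/-- **The inverse `β⁻¹ = (β_m⁻¹)_m`** of a norm-coherent unit (norms are multiplicative). [cite: deShalit1987, Ch. I §2.3 (i)] -/
def RelNormCoherentUnits.inv (β : RelNormCoherentUnits hπ E) : RelNormCoherentUnits hπ E where
  val m := ⟨((β.val m : unitBall (E ⊔ ltField π m : IntermediateField F (AlgebraicClosure F))) :
      (E ⊔ ltField π m : IntermediateField F (AlgebraicClosure F)))⁻¹, by
    rw [mem_unitBall_iff, norm_inv, β.norm_eq_one, inv_one]⟩
  norm_eq_one m := by
    change ‖((β.val m : unitBall (E ⊔ ltField π m : IntermediateField F (AlgebraicClosure F))) :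
      (E ⊔ ltField π m : IntermediateField F (AlgebraicClosure F)))⁻¹‖ = 1
    rw [norm_inv, β.norm_eq_one, inv_one]
  coherent n m hnm := by
    letI := towerAlgebra (sup_le_sup_left (ltField_mono hπ hnm) E)
    change Algebra.norm _ (((β.val m : unitBall (E ⊔ ltField π m : IntermediateField F (AlgebraicClosure F))) :
      (E ⊔ ltField π m : IntermediateField F (AlgebraicClosure F)))⁻¹) =
      ((β.val n : unitBall (E ⊔ ltField π n : IntermediateField F (AlgebraicClosure F))) :
        (E ⊔ ltField π n : IntermediateField F (AlgebraicClosure F)))⁻¹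
    set x := ((β.val m : unitBall (E ⊔ ltField π m : IntermediateField F (AlgebraicClosure F))) :
      (E ⊔ ltField π m : IntermediateField F (AlgebraicClosure F))) with hx
    have hx0 : x ≠ 0 := β.coe_val_ne_zero hπ E m
    have h1 : Algebra.norm (E ⊔ ltField π n : IntermediateField F (AlgebraicClosure F)) x⁻¹ *
        Algebra.norm (E ⊔ ltField π n : IntermediateField F (AlgebraicClosure F)) x = 1 := by
      rw [← map_mul, inv_mul_cancel₀ hx0, map_one]
    rw [eq_inv_of_mul_eq_one_left h1, hx, β.coherent n m hnm]

omit [IsGalois F E] in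
/-- Components of the inverse. [cite: deShalit1987, Ch. I §2.3 (i)] -/
@[simp] theorem RelNormCoherentUnits.coe_val_inv (β : RelNormCoherentUnits hπ E) (m : ℕ) :
    (((β.inv hπ E).val m : unitBall (E ⊔ ltField π m : IntermediateField F (AlgebraicClosure F))) :
      (E ⊔ ltField π m : IntermediateField F (AlgebraicClosure F))) =
    ((β.val m : unitBall (E ⊔ ltField π m : IntermediateField F (AlgebraicClosure F))) :
      (E ⊔ ltField π m : IntermediateField F (AlgebraicClosure F)))⁻¹ := rfl

omit [IsGalois F E] in
/-- `β · β⁻¹ = 1`. [cite: deShalit1987, Ch. I §2.3 (i)] -/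
theorem RelNormCoherentUnits.mul_inv (β : RelNormCoherentUnits hπ E) : β.mul (β.inv hπ E) = RelNormCoherentUnits.one := by
  refine RelNormCoherentUnits.ext fun m => Subtype.ext ?_
  rw [RelNormCoherentUnits.val_mul, Subring.coe_mul, RelNormCoherentUnits.coe_val_inv, RelNormCoherentUnits.val_one,
    OneMemClass.coe_one, mul_inv_cancel₀ (β.coe_val_ne_zero hπ E m)]

omit [IsGalois F E] in
/-- `β ↦ β⁻¹` is continuous (inversion is continuous on the unit sphere of a normed field). [cite: SerreLocalFields1979, Ch. II §1] -/
theorem RelNormCoherentUnits.continuous_inv : Continuous fun β : RelNormCoherentUnits hπ E => β.inv hπ E := by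
  refine (RelNormCoherentUnits.continuous_iff hπ E).mpr fun m => ?_
  refine Continuous.subtype_mk ?_ _
  exact (continuous_subtype_val.comp (RelNormCoherentUnits.continuous_val_apply hπ E m)).inv₀ fun β => β.coe_val_ne_zero hπ E m

end Units

/-! ### §3. `β ↦ g_β` is continuous -/

section Coleman

variable (E : IntermediateField F (AlgebraicClosure F)) [FiniteDimensional F E] [Normal F E] [IsGalois F E]
  (hq : residueFieldCard F = 2) (hE : E ≤ maxUnramified F) {σ₀ : absoluteGaloisGroup F} (hσ₀ : IsAbsArithFrob σ₀)

omit [Normal F E] [IsGalois F E] in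
/-- `𝒪_E⟦X⟧` is compact (coefficientwise topology). [cite: BourbakiGT1, Ch. I §9.5 Th. 3] [cite: SerreLocalFields1979, Ch. II §1 Prop. 1] -/
theorem compactSpace_powerSeries_unitBall : CompactSpace (PowerSeries (unitBall E)) := by
  haveI := compactSpace_unitBall E
  exact PowerSeries.WithPiTopology.compactSpace _

include hq hE hσ₀ in
/-- ★★ **The Coleman map `β ↦ g_β` is CONTINUOUS** (`𝒰(E·K_π^∞) → 𝒪_E⟦X⟧`, coefficientwise topology): its graph
`{(β, g) | ((φ⁻¹)^{m+1} g)^ι(ω_{m+1}) = β_m ∀ m}` is closed and the target is compact. [cite: deShalit1987, Ch. I §2.2 Theorem, §3.4 Corollary] -/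
theorem continuous_relColemanSeries : Continuous fun β : RelNormCoherentUnits hπ E => relColemanSeries hπ E hq hE hσ₀ β := by
  haveI := compactSpace_powerSeries_unitBall E
  refine continuous_of_isClosed_graph' (P := fun (β : RelNormCoherentUnits hπ E) (g : PowerSeries (unitBall E)) =>
    ∀ m, evS (maxNilIdeal F (E ⊔ ltField π m : IntermediateField F (AlgebraicClosure F)))
        (inclPt (le_sup_right : ltField π m ≤ E ⊔ ltField π m) (cohPt hπ m))
        (PowerSeries.map (inclUnitBall (F := F) (le_sup_left : E ≤ E ⊔ ltField π m) :
          unitBall E →+* unitBall (E ⊔ ltField π m : IntermediateField F (AlgebraicClosure F)))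
          ((PowerSeries.map ((frobUnitBall E σ₀).symm : unitBall E →+* unitBall E))^[m + 1] g)) = β.val m) ?_ ?_
  · intro β g
    exact ⟨fun h => (eq_relColemanSeries hπ E hq hE hσ₀ h).symm, fun h => h ▸ evS_relColemanSeries hπ E hq hE hσ₀ β⟩
  · have e : {q : RelNormCoherentUnits hπ E × PowerSeries (unitBall E) | ∀ m,
        evS (maxNilIdeal F (E ⊔ ltField π m : IntermediateField F (AlgebraicClosure F)))
          (inclPt (le_sup_right : ltField π m ≤ E ⊔ ltField π m) (cohPt hπ m))
          (PowerSeries.map (inclUnitBall (F := F) (le_sup_left : E ≤ E ⊔ ltField π m) :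
            unitBall E →+* unitBall (E ⊔ ltField π m : IntermediateField F (AlgebraicClosure F)))
            ((PowerSeries.map ((frobUnitBall E σ₀).symm : unitBall E →+* unitBall E))^[m + 1] q.2)) = q.1.val m} =
        ⋂ m, {q | evS (maxNilIdeal F (E ⊔ ltField π m : IntermediateField F (AlgebraicClosure F)))
          (inclPt (le_sup_right : ltField π m ≤ E ⊔ ltField π m) (cohPt hπ m))
          (PowerSeries.map (inclUnitBall (F := F) (le_sup_left : E ≤ E ⊔ ltField π m) :
            unitBall E →+* unitBall (E ⊔ ltField π m : IntermediateField F (AlgebraicClosure F)))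
            ((PowerSeries.map ((frobUnitBall E σ₀).symm : unitBall E →+* unitBall E))^[m + 1] q.2)) = q.1.val m} := by
      ext q; simp only [Set.mem_setOf_eq, Set.mem_iInter]
    rw [e]
    refine isClosed_iInter fun m => isClosed_eq ?_ ((RelNormCoherentUnits.continuous_val_apply hπ E m).comp continuous_fst)
    refine (continuous_evS _ _).comp ?_
    refine (PowerSeries.WithPiTopology.continuous_map _ (continuous_inclUnitBall _)).comp ?_
    exact (continuous_map_iterate E (continuous_frobUnitBall_symm E σ₀) (m + 1)).comp continuous_snd

include hq hE hσ₀ in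
/-- `g_β · g_{β⁻¹} = 1`: the inverse unit of `g_β` is `g_{β⁻¹}`. [cite: deShalit1987, Ch. I §2.3 (i)] -/
theorem relColemanSeries_inv (β : RelNormCoherentUnits hπ E) :
    ((isUnit_relColemanSeries hπ E hq hE hσ₀ β).unit⁻¹ : (PowerSeries (unitBall E))ˣ) =
      (relColemanSeries hπ E hq hE hσ₀ (β.inv hπ E) : PowerSeries (unitBall E)) := by
  refine Units.inv_eq_of_mul_eq_one_right ?_
  rw [IsUnit.unit_spec, ← relColemanSeries_mul, RelNormCoherentUnits.mul_inv, relColemanSeries_one]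

/-! ### §4. `β ↦ δβ`, `β ↦ (δβ)~`, `β ↦ r_β` are continuous -/

include hq hE hσ₀ in
/-- `δβ = ω · g_β' · g_{β⁻¹}` — the logarithmic derivative without division. [cite: deShalit1987, Ch. I §3.12] -/
theorem relLogDerivSeries_eq_mul_inv (β : RelNormCoherentUnits hπ E) :
    relLogDerivSeries hπ E hq hE hσ₀ β =
      (invDiff (isLTRing_LTCoeff hπ) (isLTSeries_LTCoeff π)).map (algebraMap (LTCoeff F) (unitBall E)) *
        (PowerSeries.derivative (unitBall E) (relColemanSeries hπ E hq hE hσ₀ β) * relColemanSeries hπ E hq hE hσ₀ (β.inv hπ E)) := by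
  rw [relLogDerivSeries, relLogDeriv_def, PowerSeries.dlog_def, IsUnit.unit_spec, relColemanSeries_inv]

include hq hE hσ₀ in
/-- ★ **`β ↦ δβ = δ_E g_β` is continuous.** [cite: deShalit1987, Ch. I §3.4 Corollary, §3.12] -/
theorem continuous_relLogDerivSeries : Continuous fun β : RelNormCoherentUnits hπ E => relLogDerivSeries hπ E hq hE hσ₀ β := by
  have e : (fun β : RelNormCoherentUnits hπ E => relLogDerivSeries hπ E hq hE hσ₀ β) = fun β =>
      (invDiff (isLTRing_LTCoeff hπ) (isLTSeries_LTCoeff π)).map (algebraMap (LTCoeff F) (unitBall E)) *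
        (PowerSeries.derivative (unitBall E) (relColemanSeries hπ E hq hE hσ₀ β) * relColemanSeries hπ E hq hE hσ₀ (β.inv hπ E)) :=
    funext fun β => relLogDerivSeries_eq_mul_inv hπ E hq hE hσ₀ β
  rw [e]
  refine continuous_const.mul ?_
  exact ((PowerSeries.WithPiTopology.continuous_derivative).comp (continuous_relColemanSeries hπ E hq hE hσ₀)).mul
    ((continuous_relColemanSeries hπ E hq hE hσ₀).comp (RelNormCoherentUnits.continuous_inv hπ E))

omit [Normal F E] [IsGalois F E] in
/-- Substitution of `f = πX + X²` (read in `𝒪_E`) is continuous. [cite: BourbakiGT1, Ch. I §4.1 Prop. 1] -/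
theorem continuous_subst_map_ltSer :
    Continuous (PowerSeries.subst ((ltSer F π).map (algebraMap (LTCoeff F) (unitBall E))) : PowerSeries (unitBall E) → PowerSeries (unitBall E)) :=
  PowerSeries.WithPiTopology.continuous_subst_of_constantCoeff_eq_zero ((isLTSeries_ltSer π).map _).constantCoeff_eq_zero

include hq hE hσ₀ in
/-- ★ **`β ↦ (δβ)~ = δβ − u·((δβ)^φ ∘ f)` is continuous.** [cite: deShalit1987, Ch. I §3.4 Corollary] -/
theorem continuous_relTildeSeries (u : LTCoeff F) : Continuous fun β : RelNormCoherentUnits hπ E => relTildeSeries hπ E hq hE hσ₀ u β := by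
  unfold relTildeSeries
  refine (continuous_relLogDerivSeries hπ E hq hE hσ₀).sub (continuous_const.mul ?_)
  exact (continuous_subst_map_ltSer E).comp ((PowerSeries.WithPiTopology.continuous_map _ (continuous_frobUnitBall E σ₀)).comp
    (continuous_relLogDerivSeries hπ E hq hE hσ₀))

omit [Normal F E] [IsGalois F E] in
/-- `r ↦ (1 + u⁻¹X)·(r ∘ f)` is continuous. [cite: BourbakiGT1, Ch. I §4.1 Prop. 1] -/
theorem continuous_one_add_mul_subst (u : (LTCoeff F)ˣ) :
    Continuous fun r : PowerSeries (unitBall E) =>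
      (1 + PowerSeries.C (algebraMap (LTCoeff F) (unitBall E) (↑u⁻¹ : LTCoeff F)) * PowerSeries.X) *
        PowerSeries.subst ((ltSer F π).map (algebraMap (LTCoeff F) (unitBall E))) r :=
  continuous_const.mul (continuous_subst_map_ltSer E)

include hq hE hσ₀ in
/-- ★★ **The Coleman coordinate `β ↦ r_β ∈ 𝒪_E⟦Y⟧` is continuous** (closed graph: `(1+u⁻¹X)(r ∘ f) = (δβ)~` characterises `r_β`).
[cite: deShalit1987, Ch. I §3.4 Corollary, §3.7] -/
theorem continuous_relUnitCoordTwo (u : (LTCoeff F)ˣ) (hu : LTCoeff.of F π = residueFieldCard F * u) :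
    Continuous fun β : RelNormCoherentUnits hπ E => relUnitCoordTwo hπ E hq hE hσ₀ u hu β := by
  haveI := compactSpace_powerSeries_unitBall E
  refine continuous_of_isClosed_graph' (P := fun (β : RelNormCoherentUnits hπ E) (r : PowerSeries (unitBall E)) =>
    relTildeSeries hπ E hq hE hσ₀ (u : LTCoeff F) β =
      (1 + PowerSeries.C (algebraMap (LTCoeff F) (unitBall E) (↑u⁻¹ : LTCoeff F)) * PowerSeries.X) *
        PowerSeries.subst ((ltSer F π).map (algebraMap (LTCoeff F) (unitBall E))) r) ?_ ?_
  · intro β r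
    exact ⟨fun h => (eq_relUnitCoordTwo hπ E hq hE hσ₀ u hu β h).symm, fun h => h ▸ relTildeSeries_eq_relUnitCoordTwo hπ E hq hE hσ₀ u hu β⟩
  · exact isClosed_eq ((continuous_relTildeSeries hπ E hq hE hσ₀ (u : LTCoeff F)).comp continuous_fst)
      ((continuous_one_add_mul_subst E u).comp continuous_snd)

end Coleman

/-! ### §5. The norm and base-change maps between the towers over `E₁ ≤ E₂` are continuous -/

section BaseNorm

variable {E₁ E₂ : IntermediateField F (AlgebraicClosure F)} [FiniteDimensional F E₁] [FiniteDimensional F E₂]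
  [IsGalois F E₂]

/-- ★ **`N_{E₂/E₁} : 𝒰(E₂·K_π^∞) → 𝒰(E₁·K_π^∞)` is continuous** (componentwise relative norms). [cite: deShalit1987, Ch. I §3.8 (16)] -/
theorem RelNormCoherentUnits.continuous_baseNorm (h : E₁ ≤ E₂) :
    Continuous fun β : RelNormCoherentUnits hπ E₂ => β.baseNorm hπ h := by
  refine (RelNormCoherentUnits.continuous_iff hπ E₁).mpr fun m => ?_
  haveI := isGalois_sup_ltField hπ E₂ m
  refine Continuous.subtype_mk ?_ _
  exact (continuous_towerNorm (sup_le_sup_right h (ltField π m))).comp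
    (continuous_subtype_val.comp (RelNormCoherentUnits.continuous_val_apply hπ E₂ m))

end BaseNorm

end RelativeContinuousTwo

end Literature.NumberTheory.GaloisRepresentations
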